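import Summits.ABC.IUTFork.Conditional.AbcOfSGenuine
import Summits.ABC.ABC.Theorems.IUTThetaPilotThetaPartIIULineCapstone
import HarnessLib

/-!
# Branch C certificate AT THE GENUINE SETTING, S-layer binder cut to the route's own residue — `abc_of_S_v4` (hull-regime line)

C scoreboard v4 (`abc_of_S_v4`): apex explicit 2 (S_H-bundle `H` · CONE `hreg`) / EFFECTIVE 2; per datum unchanged from v3
(`cor312Of_of_SH_genuine`, `Conditional/AbcOfSGenuine.lean` p430884: S_H 1 · PIN 1 (+ idele side 5) · FACT 0 · CONE 0 · READ 4 = 11 named)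

PROOF-ONLY sibling of `Conditional/AbcOfS.lean` (v0–v2) and `Conditional/AbcOfSGenuine.lean` (v3; both at the 400-line limit, hence a new
module). Writer abc-iut-C-cert-1 (C-lead C-R2 SPLIT rule: a binder may be replaced only by a strictly weaker NAMED one; STATUS 2026-08-26
07:29Z SPLIT candidate). ONE theorem, `abc_of_S_v4` = `abc_of_S_v3` VERBATIM in its S_H-bundle `H` (per datum: the hull-level printed clause
`Cor312Vol.PilotKummerCompatHull` at abc-iut-c312-7's print-normalised assembled real setting `Real.settingPrVolSharp`, the q-pin, the idele
side conditions, provenance, the one-sided Θ-identification — `cor312Of_of_SH_genuine` BY NAME), with the S-layer CONE binder WEAKENED: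

* v3 `hvol` = the route's child (ii′) `Cor22.HullVolumeAtDatum P l B_III(P,l)` — the hull-volume estimate with print's Step-(iii) constant
  at EVERY genuine Θ-volume datum;
* v4 `hreg` = c312-8's `stub_hullRegime` body (route `IUTThetaPilot`, crux stmt-ABC-19678, (U)-line capstone
  `Summit.ABC.ABC.Theorems.ThetaPartII.ABC_of_cor312_of_hullRegime`, p428563): the SAME estimate demanded ONLY at genuine data that are
  NOT slot-constant (`¬ ∀ p ∈ supportPrimes, ∀ v w | p, logQloc p v = logQloc p w`). The slot-constant data — in particular every datum
  with `d_mod = 1` — are PROVED inside the capstone (`hullVolume_of_hullRegime`: abc-iut-S3/S7 junctions, c312-d1's explicit Step (v)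
  constant); [GenEll] Thm 2.1 at `Σ = {2}` is `genEllTwo_holds`. So `hvol → hreg` trivially and v4 is a STRICTLY STRONGER certificate whose
  S-layer binder is exactly VERDICT RISK ¶7's open residue (split support primes / non-slot-constant data), nothing more.

STATUS OF THE ANTECEDENT (branch-C finding of record, C-R10a): the S_H-bundle is non-vacuous at interface level
(`NaiveWitness.linkId_pilotKummerCompatHull`) and NOT refuted by volumes at the genuine setting (it is implied by, not contradicting,
`−|log q| ≤ −|log Θ|`); a kernel witness of `PilotKummerCompatHull ∧ QPinned` AT `settingPrVolSharp` with realising ideles does not exist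
yet (open either way). The identification-level S-form is kernel-refuted there (`Cor312PinnedHonestReal`, p430714).
HONEST FRAMING: locates / conditionally verifies; nothing here asserts that abc is proved or refuted or that [IUTchIII] Cor. 3.12 holds or
fails at any datum; no side taken on any author or on (U)/(P); «`ABC` follows from S_H + the listed hypotheses AS TYPED», nothing more;
typed ≠ proved. [claim: Mochizuki2012, status: disputed]
-/

noncomputable section

namespace Summit.ABC.IUTFork.Conditional

open Thm311 Thm311.Real Cor312 Cor312Vol Cor312Prov
open Literature.IUT.LogThetaLattice Literature.IUT.LogVolume Literature.IUT.HodgeTheaters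
open Literature.NumberTheory.DiophantineGeometry.GenEll NumberField IsDedekindDomain

/-- **`abc_of_S_v4` — the branch-C certificate at the genuine print-normalised assembled real setting (hull-level line S_H), with the
S-layer binder cut to the route's own open residue.** HYPOTHESES: [S_H-bundle] `H` — verbatim as in `abc_of_S_v3` (per admissible
`(λ, l)` and genuine Θ-volume datum `T`: setting data EXIST with the idele side conditions, the provenance, the hull-level printed clause
`PilotKummerCompatHull`, the q-pin, and the one-sided Θ-identification; consumed through `cor312Of_of_SH_genuine`); [CONE, layer S]
`hreg` — the hull estimate with print's `B_III(λ,l)` at NON-slot-constant genuine data only (c312-8 `stub_hullRegime`; slot-constant data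
PROVED). Downstream BY NAME: `Summit.ABC.ABC.Theorems.ThetaPartII.ABC_of_cor312_of_hullRegime` (p428563; `genEllTwo_holds`, `JInvWlog_proof`,
[IUTchIV] Cor 2.2/2.3 inside). «`ABC` follows from S_H + these hypotheses as typed», nothing more; no side taken on [IUTchIII] Cor. 3.12
or on any author; typed ≠ proved. [claim: Mochizuki2012, status: disputed] -/
theorem abc_of_S_v4
    (H : ∀ P₀ : NFPoint, P₀ ∈ UP → ∀ l : ℕ, l.Prime → 5 ≤ l →
      Cor22.AdmitsCore P₀ → Cor22.CondP2 P₀ l → Cor22.CondP5 P₀ l → Cor22.CondP6 P₀ l →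
      ∀ T : Cor22.ThetaVolumeDatumAt P₀ l,
        letI := T.instFieldF; letI := T.instNumberFieldF; letI := T.instFieldK; letI := T.instNumberFieldK
        letI := T.instAlgebraK; letI := T.instFieldFbar; letI := T.instAlgebraFbar; letI := T.instAlgebraKFbar
        letI := T.instIsElliptic
        ∃ (X : PilotData T.F) (M : Type) (_ : Field M) (_ : NumberField M)
          (archPk : ∀ (j : (thetaIndex X).Label) (vQ : (thetaIndex X).VQ), Set ((logShellsDH X (analyticLogv T.F)).Packet j vQ))
          (archSub : ∀ (j : (thetaIndex X).Label) (v : (thetaIndex X).V),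
            Set ((logShellsDH X (analyticLogv T.F)).Packet j ((thetaIndex X).over v)))
          (Ψ : ℤ → ∀ v : (thetaIndex X).V, v ∈ (thetaIndex X).Vbad → Set ((logShellsDH X (analyticLogv T.F)).StarPacket v))
          (act : ℤ → ∀ v : (thetaIndex X).V, v ∈ (thetaIndex X).Vbad →
            (logShellsDH X (analyticLogv T.F)).StarPacket v → Module.End ℚ ((logShellsDH X (analyticLogv T.F)).StarPacket v))
          (Mmod : ℤ → ∀ j : (thetaIndex X).LabelStar, Set ((logShellsDH X (analyticLogv T.F)).GlobalPacket j.1))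
          (region : ℤ → ∀ j : (thetaIndex X).LabelStar, FinDivisor M → ∀ vQ : (thetaIndex X).VQ,
            Set ((logShellsDH X (analyticLogv T.F)).Packet j.1 vQ))
          (frobAdm : ℤ → ℤ → ∀ (j : (thetaIndex X).Label) (vQ : (thetaIndex X).VQ),
            Set ((logShellsDH X (analyticLogv T.F)).Packet j vQ) → Prop)
          (frobLogvol : ℤ → ℤ → ∀ (j : (thetaIndex X).Label) (vQ : (thetaIndex X).VQ),
            Set ((logShellsDH X (analyticLogv T.F)).Packet j vQ) → ℝ)
          (frobΨ : ℤ → ℤ → ∀ v : (thetaIndex X).V, v ∈ (thetaIndex X).Vbad →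
            Set ((logShellsDH X (analyticLogv T.F)).StarPacket v))
          (frobMmod : ℤ → ℤ → ∀ j : (thetaIndex X).LabelStar, Set ((logShellsDH X (analyticLogv T.F)).GlobalPacket j.1))
          (unitImage : ℤ → ℤ → ℕ → ∀ (j : (thetaIndex X).Label) (vQ : (thetaIndex X).VQ),
            Set ((logShellsDH X (analyticLogv T.F)).Packet j vQ))
          (ballImage : ℤ → ℤ → ∀ (j : (thetaIndex X).Label) (vQ : (thetaIndex X).VQ),
            Set ((logShellsDH X (analyticLogv T.F)).Packet j vQ))
          (thetaDiv : ℤ → ℤ → LgpDivisor M (thetaIndex X).lstar)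
          (n : ℤ) (HT : Type) (LogLink : HT → HT → Type) (IsFull : ∀ {s t : HT}, LogLink s t → Prop)
          (lat : LGPGaussianLogThetaLattice LogLink IsFull)
          (Frd : Type) (IsoF : Frd → Frd → Type) (Ob : Frd → Type) (realify : Frd → Frd) (Strip : Type)
          (IsoS : Strip → Strip → Type) (Mv : ∀ v : (thetaIndex X).V, v ∈ (thetaIndex X).Vbad → Type)
          (_ : ∀ v h, Monoid (Mv v h))
          (sig : GlobalLGPFrobenioidSignature (thetaIndex X).lstar (thetaIndex X).V (· ∈ (thetaIndex X).Vbad)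
            Frd IsoF Ob realify Strip IsoS Mv)
          (split : SplittingMonoids Mv) (ObΔ : Type) (N : ∀ v : (thetaIndex X).V, v ∈ (thetaIndex X).Vbad → Type)
          (_ : ∀ v h, Monoid (N v h)) (qData : QPilotData ObΔ N)
          (tq : ∀ (pp : Nat.Primes) (x : (thetaIndex X).Fibre (.inr pp)), haveI : Fact (pp : ℕ).Prime := ⟨pp.2⟩; kOf X pp.1 x)
          (t : ∀ (pp : Nat.Primes) (_ : Fin X.lstar) (x : (thetaIndex X).Fibre (.inr pp)),
            haveI : Fact (pp : ℕ).Prime := ⟨pp.2⟩; kOf X pp.1 x)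
          (ρ : (∀ v : (thetaIndex X).V, v ∈ (thetaIndex X).Vbad → Set ((logShellsDH X (analyticLogv T.F)).StarPacket v)) →
            ∀ (j : (thetaIndex X).Label) (vQ : (thetaIndex X).VQ), Set ((logShellsDH X (analyticLogv T.F)).Packet j vQ))
          (qK : ∀ v : (thetaIndex X).V, v ∈ (thetaIndex X).Vbad → Set ((logShellsDH X (analyticLogv T.F)).StarPacket v))
          (htq0 : ∀ pp x, tq pp x ≠ 0)
          (htq1 : ∀ (pp : Nat.Primes) (x : (thetaIndex X).Fibre (.inr pp)),
            haveI : Fact (pp : ℕ).Prime := ⟨pp.2⟩; placeOf X pp.1 x ∉ X.S → ‖tq pp x‖ = 1)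
          (_ : ∀ (pp : Nat.Primes) (x : (thetaIndex X).Fibre (.inr pp)),
            haveI : Fact (pp : ℕ).Prime := ⟨pp.2⟩
            Real.log ‖tq pp x‖ = -(X.qPilot (placeOf X pp.1 x)) * logNorm T.F (placeOf X pp.1 x) /
              localDegree T.F (placeOf X pp.1 x))
          (_ : ∀ pp i x, t pp i x ≠ 0)
          (_ : ∀ (pp : Nat.Primes) (i : Fin X.lstar) (x : (thetaIndex X).Fibre (.inr pp)),
            haveI : Fact (pp : ℕ).Prime := ⟨pp.2⟩; placeOf X pp.1 x ∉ X.S → ‖t pp i x‖ = 1)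
          (_ : IsPilotDataOf T.D X)
          (_ : ∃ e : (thetaIndex X).V ≃ T.D.V, ∀ v : (thetaIndex X).V,
            v ∈ (thetaIndex X).Vbad ↔ ((e v : T.D.V) : Val T.K) ∈ T.D.Vbad),
          Cor312Vol.PilotKummerCompatHull
              (LatticeSituation.ofShells (logShellsDH X (analyticLogv T.F)) M archPk archSub
                (summandPiecesPr X (logvAnalytic_analyticLogv (F := T.F))).Adm
                (summandPiecesPr X (logvAnalytic_analyticLogv (F := T.F))).logvol Ψ act Mmod region
                frobAdm frobLogvol frobΨ frobMmod unitImage ballImage thetaDiv)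
              (settingPrVolSharp X (logvAnalytic_analyticLogv (F := T.F)) M archPk archSub Ψ act Mmod region n lat sig split
                qData tq t htq0 htq1) ρ qK ∧
            Cor312Vol.QPinned
              (LatticeSituation.ofShells (logShellsDH X (analyticLogv T.F)) M archPk archSub
                (summandPiecesPr X (logvAnalytic_analyticLogv (F := T.F))).Adm
                (summandPiecesPr X (logvAnalytic_analyticLogv (F := T.F))).logvol Ψ act Mmod region
                frobAdm frobLogvol frobΨ frobMmod unitImage ballImage thetaDiv)
              (settingPrVolSharp X (logvAnalytic_analyticLogv (F := T.F)) M archPk archSub Ψ act Mmod region n lat sig split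
                qData tq t htq0 htq1) ρ qK ∧
            (settingPrVolSharp X (logvAnalytic_analyticLogv (F := T.F)) M archPk archSub Ψ act Mmod region n lat sig split qData
                tq t htq0 htq1).negLogTheta ≤ ((T.negLogTheta : ℝ) : WithTop ℝ))
    -- [CONE, layer S] the route's own open residue `stub_hullRegime` (RISK ¶7): the hull estimate with print's B_III(λ, l) is
    -- demanded ONLY at NON-slot-constant genuine data (slot-constant data, in particular d_mod = 1, are PROVED inside c312-8's capstone)
    (hreg : ∀ P : NFPoint, P ∈ UP → ∀ l : ℕ, l.Prime → 5 ≤ l →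
      Cor22.AdmitsCore P → Cor22.CondP2 P l → Cor22.CondP5 P l → Cor22.CondP6 P l →
      ∀ T : Cor22.ThetaVolumeDatumAt P l,
        (letI := T.instFieldF; letI := T.instNumberFieldF; letI := T.instAlgebraF; letI := T.instFieldK
         letI := T.instNumberFieldK; letI := T.instAlgebraK; letI := T.instFieldFbar; letI := T.instAlgebraFbar
         letI := T.instAlgebraKFbar; letI := T.instIsElliptic
         ¬ (∀ p ∈ T.I.supportPrimes, ∀ v w : placesOver (fieldOfModuli T.E) p,
            (Summit.ABC.IUTFork.DHData.ofInput T.I).logQloc p v = (Summit.ABC.IUTFork.DHData.ofInput T.I).logQloc p w)) →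
        T.HullEstimateOf
          (((l : ℝ) + 1) / 4 *
            ((1 + 12 * (Cor22.dmod P : ℝ) / l) * (P.logDiff + Cor22.logCondAvoid P {2, l})
              + 2 * Real.log l + 52
              + 20 / 3 * Real.log (((2 ^ 12 * 3 ^ 3 * 5 * Cor22.dmod P : ℕ) : ℝ) * (l : ℝ))
                * (Nat.primeCounting (2 ^ 12 * 3 ^ 3 * 5 * Cor22.dmod P * l) : ℝ)))) :
    _root_.ABC := by
  refine Summit.ABC.ABC.Theorems.ThetaPartII.ABC_of_cor312_of_hullRegime (fun P₀ hP l hl h5 hc h2 h5' h6 => ?_) hreg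
  intro T
  letI := T.instFieldF; letI := T.instNumberFieldF; letI := T.instFieldK; letI := T.instNumberFieldK
  letI := T.instAlgebraK; letI := T.instFieldFbar; letI := T.instAlgebraFbar; letI := T.instAlgebraKFbar
  letI := T.instIsElliptic
  obtain ⟨X, M, _, _, archPk, archSub, Ψ, act, Mmod, region, frobAdm, frobLogvol, frobΨ, frobMmod, unitImage, ballImage,
    thetaDiv, n, HT, LogLink, IsFull, lat, Frd, IsoF, Ob, realify, Strip, IsoS, Mv, _, sig, split, ObΔ, N, _, qData, tq, t, ρ, qK,
    htq0, htq1, htq, ht0, ht1, hX, hplaces, hSH, hQPin, hΘ⟩ := H P₀ hP l hl h5 hc h2 h5' h6 T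
  exact cor312Of_of_SH_genuine T.D T.I X M archPk archSub Ψ act Mmod region frobAdm frobLogvol frobΨ frobMmod unitImage ballImage
    thetaDiv n lat sig split qData tq t ρ qK htq0 htq1 htq ht0 ht1 T.isVolumeInputOf hX hplaces hSH hQPin hΘ

end Summit.ABC.IUTFork.Conditional

end
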